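import Summits.ResolutionOfSingularities.ResolutionOfSingularities.Theorems.NearCutCompanion2
import HarnessLib

/-!
# NearCutCompanion3 — decomp-res node «NearCut» (lens-3 g22, critic row 170), tree file 6/10 of the node

Content VERBATIM from the decomp-res lens-3 g22 node `HOME/decomp-res-lens-3/g22/NearCut.lean` (pin 52e91527; HOME =
run/shared/lean/pub/decomp-res); critic row 170
BOOKED 0·0; landing orders INBOX :715 / :727 — provenance, critic text and the lens header in full in the first file
of the node, `NearCutForms`.  Namespace
`…Theorems.NearCut`; `--supports stmt-ResolutionOfSingularities-31770`; linear import chain in the lens's order.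

## This file

Continuation 3/3 of `NearCutCompanion` (same sections of the node, cut at the 400-line cap): carries
`layer_of_structure`, `monomial_mul_strip`, `st_succ_F`, `st_succ_r`, `ordZero_eq_degree_add`, `lt_of_balanced`,
`TailInv`, `tailInv_zero`, `tailInv_succ`, `shade_of_plateau`, `tailInv_of_balanced`, `companionLaw`.

[WRITER NOTE (decomp-res writer g10): file split only (tree files ≤ 400 lines); namespace blocks, sections, section
variables, `open` lines and every declaration
exactly as in the lens; the three deprecated `Finsupp.degree_add` occurrences read `map_add` (definitionally the same lemma).]

(Sources: cossart2020 (Cossart–Jannsen–Saito LNM 2270: Thm 5.40 p. 85, Defs 5.38/5.39 pp. 84–85, Thm 5.28 p. 72, Thm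
5.35 / Cor 5.37); HauserPerlega2024 (Prop. 3 p. 791); Hauser2010Kangaroo (arXiv:0811.4151); Moh1987;
CossartPiltant2008 §2; Giraud1975; Hironaka1964.)
-/

noncomputable section

open MvPolynomial Finset
open Literature.AlgebraicGeometry.Resolution
open Literature.AlgebraicGeometry.Resolution.Hauser2010
open Literature.AlgebraicGeometry.Resolution.PointBlowup
open Summit.ResolutionOfSingularities.ResolutionOfSingularities.Theses
open Summit.ResolutionOfSingularities.ResolutionOfSingularities.Theorems.TightDefectClasses
open Summit.ResolutionOfSingularities.ResolutionOfSingularities.Theorems.TightDefectStrongWalks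
open Summit.ResolutionOfSingularities.ResolutionOfSingularities.Theorems.ItineraryCutClasses
open Summit.ResolutionOfSingularities.ResolutionOfSingularities.Theorems.BoundaryLedger
open Summit.ResolutionOfSingularities.ResolutionOfSingularities.Theorems.ProximityCut
open Summit.ResolutionOfSingularities.ResolutionOfSingularities.Theorems.ConeCutAxisLaw
open Literature.AlgebraicGeometry.Resolution.WeightedBlowup
open Literature.Barriers.ResolutionOfSingularities
open Summit.ResolutionOfSingularities.ResolutionOfSingularities.Theorems.FloorCut
open Summit.ResolutionOfSingularities.ResolutionOfSingularities.Theorems.ConeCut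
open Summit.ResolutionOfSingularities.ResolutionOfSingularities.Theorems.ExitLaw (fin3_cases eq_of_le_of_degree_le)
open Summit.ResolutionOfSingularities.ResolutionOfSingularities.Theorems.ShadeCut
open Summit.ResolutionOfSingularities.ResolutionOfSingularities.Theorems.TightCut
open Summit.ResolutionOfSingularities.ResolutionOfSingularities.Theorems.HoleCut

namespace Summit.ResolutionOfSingularities.ResolutionOfSingularities.Theorems.NearCut

open Literature.AlgebraicGeometry.Resolution.HauserPerlega2024 (chartTransform_add)

section Structure

variable {K : Type} [Field K] [DecidableEq K]

omit [DecidableEq K] in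
/-- **LAYER (kernel form).**  Under the same structure with `s ≤ ord G`: `in_{|r|+s}(F) = U(0) · y^r · in_s(G)`.
[new] [folklore] -/
theorem layer_of_structure {q δ s : ℕ} (hδs : δ + s = q) (hδ : 0 < δ) (hs : 1 ≤ s)
    {F U G Cq : MvPolynomial (Fin 3) K} {r : Fin 3 →₀ ℕ}
    (hclean : deletePthPowers q F = F) (hCq : IsQPoly q Cq)
    (hF : F = monomial r 1 * U * G + Cq) (hoG : (s : ℕ∞) ≤ ordZero G)
    {y₁ y₂ : Fin 3} (hy : y₁ ≠ y₂) (h1 : r y₁ = δ) (h2 : r y₂ = δ) :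
    homogeneousComponent (r.degree + s) F = C (constantCoeff U) * (monomial r 1 * homogeneousComponent s G) := by
  classical
  rw [homogeneousComponent_eq_of_add_qPoly hclean hCq hF (r.degree + s) ?_, homogeneousComponent_boundary_mul r U hoG]
  · ring
  · intro d hd hne
    rw [mul_assoc, coeff_monomial_mul'] at hne
    split_ifs at hne with hle
    · rw [one_mul] at hne
      have hm : (d - r).degree = s := by rw [degree_tsub_of_le hle]; omega
      have hd' : r + (d - r) = d := add_tsub_cancel_of_le hle
      have key := not_qpow_on_two_walls hδs hδ hy h1 h2 (m := d - r) (by omega)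
      rwa [hd'] at key
    · exact (hne rfl).elim

end Structure

section CompanionWalk

variable {K : Type} [Field K] [DecidableEq K] {q : ℕ} {s₀ : State (Fin 3) K}

/-- `y^{r_t} · strip_t = F_t`. [folklore] -/
theorem monomial_mul_strip (hroot : IsRoot q s₀) (W : ForcedWalk q s₀) (t : ℕ) :
    monomial (W.st t).r 1 * strip (W.st t) = (W.st t).F := by
  classical
  unfold strip
  rw [Finset.mul_sum]
  conv_rhs => rw [(W.st t).F.as_sum]
  refine Finset.sum_congr rfl fun d hd => ?_
  rw [monomial_mul, one_mul, add_tsub_cancel_of_le (walk_r hroot W t d hd)]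

/-- The step of the residual equation. [folklore] -/
theorem st_succ_F (W : ForcedWalk q s₀) (t : ℕ) :
    (W.st (t + 1)).F = deletePthPowers q (translate (W.b t) (chartTransform q (W.j t) (W.st t).F)) := by
  rw [W.st_succ]; rfl

/-- The step of the boundary. [folklore] -/
theorem st_succ_r (W : ForcedWalk q s₀) (t : ℕ) :
    (W.st (t + 1)).r
      = ((W.st t).r.filter fun i => W.b t i = 0).update (W.j t) ((ordZero (W.st t).F).toNat - q) := by
  rw [W.st_succ]; rfl

/-- `o_t = |r_t| + s_t` in ℕ. [folklore] -/
theorem ordZero_eq_degree_add (hroot : IsRoot q s₀) (W : ForcedWalk q s₀) (t s : ℕ)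
    (hsh : (W.st t).shade = (s : ℕ∞)) : ordZero (W.st t).F = (((W.st t).r.degree + s : ℕ) : ℕ∞) := by
  obtain ⟨o, ho, -⟩ := walk_nat hroot W t
  obtain ⟨s', hs', hos⟩ := order_eq_shade_add_degree hroot W t ho
  rw [hsh] at hs'
  have hss : s = s' := by exact_mod_cast hs'
  rw [ho, hos, ← hss, add_comm]

/-- Numerics of a balanced stage: `s < q`. [folklore] -/
theorem lt_of_balanced (hroot : IsRoot q s₀) (W : ForcedWalk q s₀) (t s : ℕ) (hsh : (W.st t).shade = (s : ℕ∞))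
    (hbig : ordZero (W.st t).F ≠ (q : ℕ∞)) (hbal : (W.st t).r.degree + 2 * s = 2 * q) : s < q := by
  have ho := ordZero_eq_degree_add hroot W t s hsh
  have hne : (W.st t).r.degree + s ≠ q := fun h => hbig (by rw [ho, h])
  omega

/-- **THE STRUCTURE INVARIANT** of a δ-balanced tail: `F_{N+n} = y^{r}·U·G_n + C` with `U(0) ≠ 0`, `C ∈ K[y^q]`,
`ord G_n = s`. DEFINITION. -/
def TailInv (W : ForcedWalk q s₀) (N s n : ℕ) : Prop :=
  ∃ U Cq : MvPolynomial (Fin 3) K, constantCoeff U ≠ 0 ∧ IsQPoly q Cq ∧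
    (W.st (N + n)).F = monomial (W.st (N + n)).r 1 * U * companion W N s n + Cq ∧
    ordZero (companion W N s n) = (s : ℕ∞)

/-- Base of the invariant. [folklore] -/
theorem tailInv_zero (hroot : IsRoot q s₀) (W : ForcedWalk q s₀) (N s : ℕ) (hs : (W.st N).shade = (s : ℕ∞)) :
    TailInv W N s 0 := by
  classical
  have hF := monomial_mul_strip hroot W N
  refine ⟨1, 0, by simp, isQPoly_zero q, ?_, ?_⟩
  · show (W.st N).F = monomial (W.st N).r 1 * 1 * strip (W.st N) + 0
    rw [mul_one, add_zero, hF]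
  · show ordZero (strip (W.st N)) = (s : ℕ∞)
    have ho := ordZero_eq_degree_add hroot W N s hs
    have hne : strip (W.st N) ≠ 0 := by
      intro h
      rw [h, mul_zero] at hF
      exact ne_zero_of_ordZero_eq_natCast ho hF.symm
    obtain ⟨g, hg⟩ := exists_ordZero_eq_natCast hne
    have hord : ordZero (W.st N).F = ordZero (monomial (W.st N).r (1 : K)) + ordZero (strip (W.st N)) := by
      rw [← ordZero_mul, hF]
    rw [ho, ordZero_monomial _ one_ne_zero, hg] at hord
    have : (W.st N).r.degree + s = (W.st N).r.degree + g := by exact_mod_cast hord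
    rw [hg]; congr 1; omega

/-- **THE INDUCTIVE STEP** of the structure invariant across one move of a δ-balanced plateau: multiplicativity of the
chart transform (`cT_q(y^rU·G) = cT_δ(y^rU)·cT_s(G)`), the boundary factor, `K[y^q]`-bookkeeping of the cleaning,
and NEAR. [new] [folklore] -/
theorem tailInv_succ {p e : ℕ} (hp : p.Prime) [CharP K p] {s₀ : State (Fin 3) K} (hroot : IsRoot (p ^ e) s₀)
    (W : ForcedWalk (p ^ e) s₀) (N s n : ℕ)
    (hsh : (W.st (N + n)).shade = (s : ℕ∞)) (hsh' : (W.st (N + n + 1)).shade = (s : ℕ∞))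
    (hbig : ordZero (W.st (N + n)).F ≠ ((p ^ e : ℕ) : ℕ∞))
    (hbal : (W.st (N + n)).r.degree + 2 * s = 2 * p ^ e)
    (hbal' : (W.st (N + n + 1)).r.degree + 2 * s = 2 * p ^ e ∧
      ∃ x, (W.st (N + n + 1)).r x = 0 ∧ ∀ y, y ≠ x → (W.st (N + n + 1)).r y + s = p ^ e)
    (h : TailInv W N s n) : TailInv W N s (n + 1) := by
  classical
  haveI := Fact.mk hp
  obtain ⟨U, Cq, hU, hCq, hF, hord⟩ := h
  -- numerics at stage `N + n`
  have hslt : s < p ^ e := lt_of_balanced hroot W (N + n) s hsh hbig hbal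
  have ho := ordZero_eq_degree_add hroot W (N + n) s hsh
  obtain ⟨δ, hδ⟩ : ∃ δ, δ = p ^ e - s := ⟨_, rfl⟩
  have hδpos : 0 < δ := by omega
  have hδs : δ + s = p ^ e := by omega
  have hrdeg : (W.st (N + n)).r.degree = 2 * δ := by omega
  -- the chart transform of `y^r U · G`
  have hP : (δ : ℕ∞) ≤ ordZero (monomial (W.st (N + n)).r (1 : K) * U) := by
    refine le_trans ?_ (le_ordZero_mul_right _ _)
    rw [ordZero_monomial _ one_ne_zero]
    exact_mod_cast (show δ ≤ (W.st (N + n)).r.degree by omega)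
  have hQ : (s : ℕ∞) ≤ ordZero (companion W N s n) := hord.ge
  have hmul := chartTransform_mul_of_le (W.j (N + n)) hP hQ
  rw [hδs] at hmul
  obtain ⟨U', hU', hB⟩ :=
    boundary_step (W.j (N + n)) (W.b (N + n)) (W.onExc (N + n)) (W.st (N + n)).r (δ := δ) (by omega) hU
  rw [hrdeg, show 2 * δ - δ = δ by omega] at hB
  -- the translated chart transform `T` of `F`
  have hTeq : translate (W.b (N + n)) (chartTransform (p ^ e) (W.j (N + n)) (W.st (N + n)).F)
      = monomial (((W.st (N + n)).r.filter fun i => W.b (N + n) i = 0).update (W.j (N + n)) δ) 1 * U'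
          * companion W N s (n + 1)
        + translate (W.b (N + n)) (chartTransform (p ^ e) (W.j (N + n)) Cq) := by
    rw [hF, chartTransform_add, HauserPerlega2024.translate_add, hmul, Rescue.ToricGuard.translate_mul_comm, hB, companion_succ]
  -- the new boundary exponent
  have hr' : (W.st (N + n + 1)).r = ((W.st (N + n)).r.filter fun i => W.b (N + n) i = 0).update (W.j (N + n)) δ := by
    rw [st_succ_r, ho, ENat.toNat_coe]
    congr 1
    omega
  -- the new structure
  have hF' : (W.st (N + n + 1)).F
      = monomial (W.st (N + n + 1)).r 1 * U' * companion W N s (n + 1)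
        + (translate (W.b (N + n)) (chartTransform (p ^ e) (W.j (N + n)) Cq)
          - (translate (W.b (N + n)) (chartTransform (p ^ e) (W.j (N + n)) (W.st (N + n)).F)
            - deletePthPowers (p ^ e)
                (translate (W.b (N + n)) (chartTransform (p ^ e) (W.j (N + n)) (W.st (N + n)).F)))) := by
    rw [st_succ_F, hr', hTeq]
    ring
  have hCq' : IsQPoly (p ^ e) (translate (W.b (N + n)) (chartTransform (p ^ e) (W.j (N + n)) Cq)
      - (translate (W.b (N + n)) (chartTransform (p ^ e) (W.j (N + n)) (W.st (N + n)).F)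
        - deletePthPowers (p ^ e)
          (translate (W.b (N + n)) (chartTransform (p ^ e) (W.j (N + n)) (W.st (N + n)).F)))) :=
    (isQPoly_translate e _ (isQPoly_chartTransform _ hCq)).sub (isQPoly_sub_deletePthPowers _ _)
  -- NEAR at stage `N + n + 1`
  obtain ⟨y₁, y₂, hy, h1, h2⟩ := two_walls hbal'.2
  rw [← hδ] at h1 h2
  have ho' := ordZero_eq_degree_add hroot W (N + n + 1) s hsh'
  have hnear := near_of_structure hδs hδpos (walk_clean hroot W (N + n + 1)) hU' hCq' hF' ho' hy h1 h2
  exact ⟨U', _, hU', hCq', hF', hnear⟩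

/-- Shade constancy along a plateau. [folklore] -/
theorem shade_of_plateau (W : ForcedWalk q s₀) (N s : ℕ) (hplat : ∀ t, N ≤ t → (W.st (t + 1)).shade = (W.st t).shade)
    (hs : (W.st N).shade = (s : ℕ∞)) : ∀ t, N ≤ t → (W.st t).shade = (s : ℕ∞) := by
  intro t ht
  induction t, ht using Nat.le_induction with
  | base => exact hs
  | succ t ht ih => rw [hplat t ht, ih]

/-- **THE STRUCTURE INVARIANT HOLDS ALONG EVERY δ-BALANCED PLATEAU** (binders of `CompanionLaw`). [new] [folklore] -/
theorem tailInv_of_balanced {p e : ℕ} (hp : p.Prime) [CharP K p] {s₀ : State (Fin 3) K} (hroot : IsRoot (p ^ e) s₀)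
    (W : ForcedWalk (p ^ e) s₀) (N : ℕ) (hplat : ∀ t, N ≤ t → (W.st (t + 1)).shade = (W.st t).shade)
    (hbig : ∀ t, N ≤ t → ordZero (W.st t).F ≠ ((p ^ e : ℕ) : ℕ∞)) (s : ℕ) (hs : (W.st N).shade = (s : ℕ∞))
    (hbal : ∀ t, N ≤ t → ((W.st t).r.degree + 2 * s = 2 * p ^ e ∧
      ∃ x, (W.st t).r x = 0 ∧ ∀ y, y ≠ x → (W.st t).r y + s = p ^ e)) :
    ∀ n, TailInv W N s n := by
  have hshade := shade_of_plateau W N s hplat hs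
  intro n
  induction n with
  | zero => exact tailInv_zero hroot W N s hs
  | succ n ih =>
    exact tailInv_succ hp hroot W N s n (hshade _ (by omega)) (hshade _ (by omega)) (hbig _ (by omega))
      (hbal _ (by omega)).1 (hbal _ (by omega)) ih

/-- **THE COMPANION LAW (PROVED).** [folklore] -/
theorem companionLaw : CompanionLaw := by
  intro p hp e he K _ _ _ _ s₀ hroot W N hplat hbig s hs h2 hbal
  classical
  have hshade := shade_of_plateau W N s hplat hs
  have hinv := tailInv_of_balanced hp hroot W N hplat hbig s hs hbal
  intro n
  obtain ⟨U, Cq, hU, hCq, hF, hord⟩ := hinv n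
  refine ⟨hord, constantCoeff U, hU, ?_⟩
  have hslt : s < p ^ e :=
    lt_of_balanced hroot W (N + n) s (hshade _ (by omega)) (hbig _ (by omega)) (hbal _ (by omega)).1
  obtain ⟨y₁, y₂, hy, h1, h2⟩ := two_walls (hbal (N + n) (by omega)).2
  exact layer_of_structure (δ := p ^ e - s) (by omega) (by omega) (by omega) (walk_clean hroot W (N + n)) hCq hF
    hord.ge hy h1 h2

end CompanionWalk

end Summit.ResolutionOfSingularities.ResolutionOfSingularities.Theorems.NearCut
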